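import Summits.ResolutionOfSingularities.ResolutionOfSingularities.Theorems.FrobeniusClosingPatchingRelPerfectDepthTargetsDefs
import Summits.ResolutionOfSingularities.ResolutionOfSingularities.Theorems.FrobeniusClosingPatchingRelPerfectDepthOneExceptionalPackage
import HarnessLib

/-!
# Crux `PatchingRelPerfect` (stmt-ResolutionOfSingularities-16161), chain w52 — R4, piece I_ℓ BY NAME:
# `DepthTargets.ExceptionalPackagePow ℓ` holds for every `ℓ`

[OURS · L1 W5.2 · rung tool] res-L1-w52-plan-1 g6 FILED + STEER TargetsF1 (2026-08-27, assignment (b),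
hand res-D-pv-055): the typed target I_ℓ of `…DepthTargetsDefs.lean` (`DepthTargets.ExceptionalPackagePow ℓ`)
— for `S` regular local of dimension `4`, `x` spanning `𝔪`, `I ≠ 0` of exceptional depth `ℓ` (`I ⊆ 𝔪ᵈ`,
`x_i^{d+ℓ} ∈ I`), the depth-`ℓ` invariant `DepthInvariant ℓ S I E X i g K` holds at an initial state with
`E` integral, Noetherian, excellent, of dimension `3`, and locally of finite type over the residue field —
PROVED at the MODEL `X = Bl_𝔪 Spec S` (`affineBlowup` on a regular system of parameters `y`),
`E = V(𝔪𝒪_X)`, `i = subschemeι`, `M = 𝓘_Eᵈ`, `K = (I𝒪_X : 𝓘_Eᵈ)` the controlled transform: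

* `DepthOne.layered_format_of_one_le` — the general-`ℓ` FORMAT `I𝒪_X = 𝓘_Eᵈ · K` with `𝓘_E^ℓ ≤ K` under
  `1 ≤ d + ℓ` (res-D-pv-016's `DepthOne.layered_format` is the case `0 < ℓ`; `ℓ = 0`, `d ≥ 1` is the
  same cancellation), and `DepthOne.controlledTransform_eq_top_of_eq_top` — the corner `I = ⊤` (forced when
  `d + ℓ = 0`): `K = ⊤`;
* `DepthOne.exists_hom_exceptional_residueField'` — the structure morphism `q : E ⟶ Spec κ`,
  `κ = IsLocalRing.ResidueField S`, with `q ≫ Spec(residue) = i ≫ g`, hence `LocallyOfFiniteType q`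
  (`DepthOne.locallyOfFiniteType_of_fac`);
* `DepthOne.exceptionalPackagePow_model` — the invariant BY NAME plus the side conditions at the model
  (geometric fields, `E` integral / Noetherian / excellent / `dim E = m` from res-L1-w52-stub-3's
  p493964/p494999 and p496054);
* `DepthTargets.exceptionalPackagePow_holds : ∀ ℓ, DepthTargets.ExceptionalPackagePow ℓ` — **I_ℓ closed
  by name** (`ℓ = 1` is I1 `DepthOneTargets.exceptionalPackage_holds`, p496769).

Perfectness of the residue field is cashed nowhere. Nothing here is a statement of the manuscript under review.

## References

* Q. Liu, *Algebraic Geometry and Arithmetic Curves* (2002), Thm. 8.1.19 (a), (b). [Liu2002]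
* J. Kollár, *Lectures on Resolution of Singularities* (2007), (3.111) Step 3. [Kollar2007]
* U. Görtz, T. Wedhorn, *Algebraic Geometry I*, 2nd ed. (2020), Prop. 13.91 (1). [GortzWedhorn2020]
-/

-- `Summit.<Summit>.<Sub>.Theorems` with `Sub = Summit` (single-conjunct summit, D-0017)
set_option linter.dupNamespace false

noncomputable section

open CategoryTheory CategoryTheory.Limits AlgebraicGeometry Literature.AlgebraicGeometry.Resolution
open IsLocalRing TopologicalSpace

namespace Summit.ResolutionOfSingularities.ResolutionOfSingularities.Theorems

universe u

namespace DepthOne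

section Format

variable {S : Type u} [CommRing S] {n : ℕ} (x : Fin n → S) {𝔪 : Ideal S}
  (hx : Ideal.span (Set.range x) = 𝔪) {X : Scheme.{u}} {g : X ⟶ Spec (.of S)}
  (hg : IsBlowup g (affineBlowup.idealSheaf 𝔪))

include hx hg in
/-- **The general-`ℓ` FORMAT on the first blow-up** under `1 ≤ d + ℓ`: for `I ⊆ 𝔪ᵈ` with
`x_i^{d+ℓ} ∈ I` for all `i` and any blowing up `g : X ⟶ Spec S` along `𝔪~`, the controlled transform
`K = (I𝒪_X : 𝓘_Eᵈ)` satisfies `I𝒪_X = 𝓘_Eᵈ · K` and **`𝓘_E^ℓ ≤ K`** (`𝓘_E^{d+ℓ} = (x_i^{d+ℓ})𝒪_X ≤ I𝒪_X`,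
cancel `𝓘_Eᵈ`; res-D-pv-016's `layered_format` is the case `0 < ℓ`).
[cite: GortzWedhorn2020, Prop. 13.91 (1)] [cite: Kollar2007, (3.111) Step 3] -/
theorem layered_format_of_one_le {I : Ideal S} {d ℓ : ℕ} (hdl : 1 ≤ d + ℓ) (hId : I ≤ 𝔪 ^ d)
    (hxI : ∀ i, x i ^ (d + ℓ) ∈ I) :
    IsEffectiveCartier ((affineBlowup.idealSheaf 𝔪).comap g ^ d) ∧
      (affineBlowup.idealSheaf 𝔪).comap g ^ ℓ ≤
        controlledTransform g (affineBlowup.idealSheaf 𝔪) (affineBlowup.idealSheaf I) d ∧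
      (affineBlowup.idealSheaf I).comap g = (affineBlowup.idealSheaf 𝔪).comap g ^ d *
        controlledTransform g (affineBlowup.idealSheaf 𝔪) (affineBlowup.idealSheaf I) d := by
  have hEd : IsEffectiveCartier ((affineBlowup.idealSheaf 𝔪).comap g ^ d) :=
    hg.isEffectiveCartier.pow d
  have hle : (affineBlowup.idealSheaf I).comap g ≤ (affineBlowup.idealSheaf 𝔪).comap g ^ d := by
    rw [← comap_pow, ← idealSheaf_pow]
    exact Scheme.IdealSheafData.comap_mono g (affineBlowup.idealSheaf_le_idealSheaf_iff.mpr hId)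
  have hfmt := hg.pow_mul_controlledTransform_eq hle
  refine ⟨hEd, ?_, hfmt.symm⟩
  apply hEd.le_of_mul_le_mul
  rw [← pow_add, hfmt, ← comap_idealSheaf_span_powers_eq_pow x hx hg hdl]
  refine Scheme.IdealSheafData.comap_mono g (affineBlowup.idealSheaf_le_idealSheaf_iff.mpr ?_)
  rw [Ideal.span_le]
  rintro _ ⟨i, rfl⟩
  exact hxI i

include hg in
/-- **The corner `I = ⊤`** (forced by exceptional depth `ℓ = 0` with `d = 0`): the controlled transform
`(⊤𝒪_X : 𝓘_E⁰)` is `⊤`, so `𝓘_E^ℓ ≤ K` holds trivially and the format reads `⊤ = 𝓘_E⁰ · ⊤`. [folklore] -/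
theorem controlledTransform_top_zero :
    controlledTransform g (affineBlowup.idealSheaf 𝔪) (affineBlowup.idealSheaf (⊤ : Ideal S)) 0 = ⊤ ∧
      (affineBlowup.idealSheaf (⊤ : Ideal S)).comap g = (affineBlowup.idealSheaf 𝔪).comap g ^ 0 *
        controlledTransform g (affineBlowup.idealSheaf 𝔪) (affineBlowup.idealSheaf (⊤ : Ideal S)) 0 := by
  have hle : (affineBlowup.idealSheaf (⊤ : Ideal S)).comap g ≤ (affineBlowup.idealSheaf 𝔪).comap g ^ 0 := by
    rw [pow_zero, Scheme.IdealSheafData.one_eq_top]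
    exact le_top
  have hfmt := hg.pow_mul_controlledTransform_eq hle
  refine ⟨?_, hfmt.symm⟩
  have h2 := hfmt
  rw [pow_zero, one_mul, affineBlowup.idealSheaf_top, Scheme.IdealSheafData.comap_top] at h2
  rw [affineBlowup.idealSheaf_top]
  exact h2

end Format

section Package

variable {S : Type u} [CommRing S] [IsRegularLocalRing S] {m : ℕ} (y : Fin (m + 1) → S)
  (hy : Ideal.span (Set.range y) = IsLocalRing.maximalIdeal S)
  (hd : (IsLocalRing.maximalIdeal S).spanFinrank = m + 1)

local notation3 "M" => Ideal.span (Set.range y)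
local notation3 "X" => affineBlowup (Ideal.span (Set.range y))
local notation3 "g" => affineBlowup.π (Ideal.span (Set.range y))
local notation3 "𝓔" => (affineBlowup.idealSheaf (Ideal.span (Set.range y))).comap
  (affineBlowup.π (Ideal.span (Set.range y)))

include hy in
/-- **`E` is a scheme over the residue field `κ = S/𝔪`**: a morphism `q : E ⟶ Spec κ` with
`q ≫ Spec(residue) = i ≫ g` (the composite `E → X → Spec S` pulls `𝔪~` back to `𝓘_E|_E = 0`; universal
property of the closed immersion `Spec κ → Spec S`). Sibling of res-L1-w52-stub-3's
`exists_hom_exceptional_residueField` (quotient by `(y)` instead of `IsLocalRing.ResidueField`). [folklore] -/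
theorem exists_hom_exceptional_residueField' :
    ∃ q : (𝓔).subscheme ⟶ Spec (.of (IsLocalRing.ResidueField S)),
      q ≫ Spec.map (CommRingCat.ofHom (IsLocalRing.residue S)) = (𝓔).subschemeι ≫ g := by
  have hker : (Spec.map (CommRingCat.ofHom (IsLocalRing.residue S))).ker ≤ ((𝓔).subschemeι ≫ g).ker := by
    rw [ker_specMap_eq_idealSheaf, IsLocalRing.ker_residue, ← hy, le_ker_iff_comap_eq_bot,
      Scheme.IdealSheafData.comap_comp]
    have h := comap_ker_self (𝓔).subschemeι
    rwa [Scheme.IdealSheafData.ker_subschemeι] at h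
  haveI : IsClosedImmersion (Spec.map (CommRingCat.ofHom (IsLocalRing.residue S))) :=
    IsClosedImmersion.spec_of_surjective _ IsLocalRing.residue_surjective
  exact ⟨IsClosedImmersion.lift _ _ hker, IsClosedImmersion.lift_fac _ _ hker⟩

/-- A morphism `q : E ⟶ Spec κ` through which `i ≫ g : E → X → Spec S` factors is locally of finite
type (`i` a closed immersion, `g` a blowing up — both locally of finite type). [folklore] -/
theorem locallyOfFiniteType_of_fac
    {q : (𝓔).subscheme ⟶ Spec (.of (IsLocalRing.ResidueField S))}
    (hq : q ≫ Spec.map (CommRingCat.ofHom (IsLocalRing.residue S)) = (𝓔).subschemeι ≫ g) :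
    LocallyOfFiniteType q := by
  haveI : IsProper (g) := (affineBlowup.isBlowup (M)).isProper
  haveI : LocallyOfFiniteType ((𝓔).subschemeι ≫ g) := inferInstance
  haveI : LocallyOfFiniteType (q ≫ Spec.map (CommRingCat.ofHom (IsLocalRing.residue S))) := by
    rw [hq]; infer_instance
  exact locallyOfFiniteType_of_comp q (Spec.map (CommRingCat.ofHom (IsLocalRing.residue S)))

include hy hd in
/-- **The depth-`ℓ` exceptional package at the model** `X = Bl_𝔪 Spec S ⊃ E = V(𝔪𝒪_X)`, `i = subschemeι`:
for `x` spanning `𝔪`, `I ⊆ 𝔪ᵈ` with `x_i^{d+ℓ} ∈ I` and (`1 ≤ d + ℓ` or `I = ⊤`), plan-1's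
`DepthTargets.DepthInvariant ℓ S I E X i g K` holds with `K = (I𝒪_X : 𝓘_Eᵈ)` (`M = 𝓘_Eᵈ`), and `E` is
integral, Noetherian, excellent, of dimension `m`, and locally of finite type over the residue field
(`y` a regular system of parameters of length `m + 1`). [cite: Liu2002, Thm. 8.1.19 (a), (b)]
[cite: Kollar2007, (3.111) Step 3] -/
theorem exceptionalPackagePow_model {n : ℕ} (x : Fin n → S)
    (hx : Ideal.span (Set.range x) = IsLocalRing.maximalIdeal S) {I : Ideal S} {d ℓ : ℕ}
    (hId : I ≤ IsLocalRing.maximalIdeal S ^ d) (hxI : ∀ i, x i ^ (d + ℓ) ∈ I)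
    (hdl : 1 ≤ d + ℓ ∨ I = ⊤) :
    DepthTargets.DepthInvariant ℓ S I (𝓔).subscheme (X) (𝓔).subschemeι (g)
        (controlledTransform (g) (affineBlowup.idealSheaf (M)) (affineBlowup.idealSheaf I) d) ∧
      IsIntegral (𝓔).subscheme ∧ IsNoetherian (𝓔).subscheme ∧ Scheme.IsExcellent (𝓔).subscheme ∧
      topologicalKrullDim (𝓔).subscheme = m ∧
      ∃ q : (𝓔).subscheme ⟶ Spec (.of (IsLocalRing.ResidueField S)), LocallyOfFiniteType q := by
  have h𝔪 : Ideal.span (Set.range x) = M := hx.trans hy.symm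
  -- the K-side: `𝓘_E^d` effective Cartier, `𝓘_E^ℓ ≤ K`, format
  have hK : IsEffectiveCartier ((𝓔) ^ d) ∧
      (𝓔).subschemeι.ker ^ ℓ ≤
        controlledTransform (g) (affineBlowup.idealSheaf (M)) (affineBlowup.idealSheaf I) d ∧
      (affineBlowup.idealSheaf I).comap (g) = (𝓔) ^ d *
        controlledTransform (g) (affineBlowup.idealSheaf (M)) (affineBlowup.idealSheaf I) d := by
    rw [Scheme.IdealSheafData.ker_subschemeι]
    rcases hdl with hdl | hI
    · exact layered_format_of_one_le x h𝔪 (affineBlowup.isBlowup (M)) hdl (by rwa [hy]) hxI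
    · subst hI
      have hd0 : d = 0 := by
        rcases Nat.eq_zero_or_pos d with h | h
        · exact h
        · exfalso
          have h1 : (1 : S) ∈ IsLocalRing.maximalIdeal S ^ d := hId Submodule.mem_top
          exact (Ideal.IsPrime.ne_top inferInstance)
            ((Ideal.eq_top_iff_one _).mpr (Ideal.pow_le_self h.ne' h1))
      subst hd0
      obtain ⟨htop, hfmt⟩ := controlledTransform_top_zero (affineBlowup.isBlowup (M))
      exact ⟨(affineBlowup.isBlowup (M)).isEffectiveCartier.pow 0, htop ▸ le_top, hfmt⟩
  obtain ⟨hEd, hle, hfmt⟩ := hK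
  obtain ⟨q, hq⟩ := exists_hom_exceptional_residueField' y hy
  exact ⟨⟨isNoetherian_blowup y, isRegular_blowup y hy, isRegular_exceptional y hy hd, inferInstance,
    ker_subschemeι_isEffectiveCartier y, map_exceptional_eq_closedPoint y hy,
    ⟨_, affineBlowup.isBlowup (M), support_idealSheaf_span_subset y hy⟩, hle, ⟨_, hEd, hfmt⟩⟩,
    isIntegral_exceptional y hy hd, isNoetherian_exceptional y, isExcellent_exceptional y hy,
    topologicalKrullDim_exceptional y hy hd, ⟨q, locallyOfFiniteType_of_fac y hq⟩⟩

end Package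

end DepthOne

namespace DepthTargets

/-- **I_ℓ by name**: plan-1's typed target `DepthTargets.ExceptionalPackagePow ℓ` holds for every `ℓ` — at
the model `Bl_𝔪 Spec S ⊃ V(𝔪𝒪)` built on a regular system of parameters (`DepthOne.exceptionalPackagePow_model`);
`I ≠ 0` is part of the binder shape and unused; the corner `d + ℓ = 0` forces `I = ⊤`.
[cite: Liu2002, Thm. 8.1.19 (a), (b)] [cite: Kollar2007, (3.111) Step 3] -/
theorem exceptionalPackagePow_holds (ℓ : ℕ) : ExceptionalPackagePow.{u} ℓ := by
  intro S _ _ hdim n x hx I _ hdepth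
  obtain ⟨hd, y, hy⟩ := DepthOne.exists_rsop_four hdim
  obtain ⟨d, hId, hxI⟩ := hdepth
  have hdl : 1 ≤ d + ℓ ∨ I = ⊤ := by
    by_cases h : 1 ≤ d + ℓ
    · exact Or.inl h
    · right
      -- `d + ℓ = 0`: some `x_i ^ 0 = 1` lies in `I` (`n ≥ 1` since `𝔪 ≠ ⊥`)
      have h0 : d + ℓ = 0 := by omega
      rcases Nat.eq_zero_or_pos n with hn | hn
      · exfalso
        subst hn
        have h𝔪 : IsLocalRing.maximalIdeal S = ⊥ := by
          rw [← hx, Set.range_eq_empty, Ideal.span_empty]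
        have := hd
        rw [h𝔪, Submodule.spanFinrank_bot] at this
        omega
      · have h1 := hxI ⟨0, hn⟩
        rw [h0, pow_zero] at h1
        exact (Ideal.eq_top_iff_one _).mpr h1
  obtain ⟨hinv, hint, hnoeth, hexc, hdimE, q, hq⟩ :=
    DepthOne.exceptionalPackagePow_model y hy hd x hx hId hxI hdl
  refine ⟨_, _, _, _, _, q, hinv, hint, hnoeth, hexc, ?_, hq⟩
  rw [hdimE]
  rfl

end DepthTargets

end Summit.ResolutionOfSingularities.ResolutionOfSingularities.Theorems

end
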